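import Literature.AlgebraicGeometry.Crystalline.DeRhamComplexSheaf
import Literature.Topology.SheafOpenRestriction
import Mathlib.AlgebraicGeometry.Restrict
import HarnessLib

/-!
# The algebraic de Rham complex restricts to open subschemes: `Ω•_{X/k}|_U ≅ Ω•_{U/k}`

For a `k`-scheme `X` (`Over (Spec k)`) and an open subscheme `U ⊆ X` with its induced `k`-scheme
structure (`openOver X U`), the restriction (`Literature.Topology.restrict`, the exact functor
`Sh(X) ⥤ Sh(U)` of `Topology/SheafOpenRestriction`) of the algebraic de Rham complex
`Crystalline.algebraicDeRhamComplex X` is the algebraic de Rham complex of `U`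
(`restrictAlgebraicDeRhamComplexIso`). Ingredients, all proved:

* `deRhamComplexPresheafWhiskerLeftIso` — the PRESHEAF de Rham complex of a restricted morphism of
  presheaves of rings `G*φ` is the restriction of that of `φ` (definitionally termwise);
* `constToPresheaf_openOver` — the structure morphism `k → 𝒪_U` is the restriction of `k → 𝒪_X`;
* `restrictDeRhamComplexSheafWhiskerLeftIso`, `restrictDeRhamComplexSheafIso` — restriction along
  an open embedding commutes with the (termwise) sheafification defining the de Rham complex of
  sheaves (Mathlib `Functor.pushforwardContinuousSheafificationCompatibility`, the functor
  `V ↦ f(V)` being continuous and cocontinuous).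

## Why

With `U = 𝒳[1/p] ⊆ 𝒳` the generic fibre of a `W(k)`-scheme (`Motives/WittSchemeGenericFibre`,
`Motives/BaseBasicOpenOver`), this identifies `Ω•_{𝒳/W}|_{𝒳[1/p]}` with `Ω•_{𝒳[1/p]/W}`, whose
hypercohomology receives the restriction maps from `ℍ•(𝒳, Ω•_{𝒳/W})`
(`Algebra/Homology/HyperExtExactFunctor`, `StupidFiltrationExactFunctor`).

## References

* The Stacks project, Tag 0FKL (the de Rham complex of a morphism of schemes; it is the
  sheafification of the naive presheaf complex and is compatible with restriction to opens).
  [StacksProject]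
* A. Grothendieck, J. Dieudonné, EGA IV₄ (Publ. Math. IHÉS 32, 1967), 16.6. [folklore]
-/

noncomputable section

open CategoryTheory TopologicalSpace Topology Opposite Limits AlgebraicGeometry

universe v₁ u₁ u

namespace Literature.AlgebraicGeometry.Crystalline

open Literature.AlgebraicGeometry.Motives DeRhamComplexPresheaf

section Presheaf

variable {D : Type u₁} [Category.{v₁} D] {D' : Type u₁} [Category.{v₁} D'] (G : D' ⥤ D)
  {S R : Dᵒᵖ ⥤ CommRingCat.{u}} (φ : S ⟶ R)

/-- The presheaf de Rham complex of the restriction `G*φ` of `φ : S ⟶ R` along a functor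
`G : D' ⥤ D` is the restriction of the presheaf de Rham complex of `φ`: the terms
`U' ↦ ⋀ⁿ Ω[R(G U')⁄S(G U')]` agree definitionally, and so do the differentials (EGA IV₄ 16.6:
the de Rham complex is local). [folklore] -/
def deRhamComplexPresheafWhiskerLeftIso :
    deRhamComplexPresheaf (Functor.whiskerLeft G.op φ) ≅
      (((Functor.whiskeringLeft _ _ AddCommGrpCat.{u}).obj G.op).mapHomologicalComplex _).obj
        (deRhamComplexPresheaf φ) :=
  HomologicalComplex.Hom.isoOfComponents (fun _ => Iso.refl _) (fun i j hij => by
    obtain rfl : i + 1 = j := hij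
    simp only [Iso.refl_hom, Functor.mapHomologicalComplex_obj_d, deRhamComplexPresheaf_d]
    rfl)

end Presheaf

section Scheme

variable {k : Type u} [CommRing k] (X : Over (Spec (CommRingCat.of k))) (U : X.left.Opens)

/-- The open subscheme `U ⊆ X` of a `k`-scheme as a `k`-scheme (`U ⊆ X → Spec k`). [folklore] -/
abbrev openOver : Over (Spec (CommRingCat.of k)) := Over.mk (U.ι ≫ X.hom)

/-- The structure morphism `k → 𝒪_U` of the open subscheme `U` (the tree's
`Motives.constToPresheaf`) is the restriction to the opens of `U` of that of `X`. [folklore] -/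
theorem constToPresheaf_openOver :
    constToPresheaf (openOver X U) =
      Functor.whiskerLeft U.ι.opensFunctor.op (constToPresheaf X) := by
  ext V : 2
  dsimp [constToPresheaf, openOver]
  change _ ≫ (_ ≫ X.left.presheaf.map _) ≫ X.left.presheaf.map _ = _ ≫ _ ≫ X.left.presheaf.map _
  simp only [Category.assoc, ← Functor.map_comp]
  rfl

end Scheme

section Sheaf

open Literature.Topology

variable {X Y : TopCat.{u}} {f : Y ⟶ X} (hf : IsOpenEmbedding f)
  {S R : (Opens X)ᵒᵖ ⥤ CommRingCat.{u}} (φ : S ⟶ R)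

/-- **The de Rham complex of sheaves restricts**: for an open embedding `f : Y ⟶ X` and
`φ : S ⟶ R` on `X`, the restriction to `Y` of the de Rham complex of sheaves of `φ` is the de Rham
complex of sheaves of the restriction `f*φ` of `φ` (restriction commutes with sheafification,
Mathlib `Functor.pushforwardContinuousSheafificationCompatibility`, and with the presheaf de Rham
complex, `deRhamComplexPresheafWhiskerLeftIso`). [cite: StacksProject, Tag 0FKL] -/
def restrictDeRhamComplexSheafWhiskerLeftIso :
    haveI := additive_restrict hf
    ((restrict hf AddCommGrpCat.{u}).mapHomologicalComplex (ComplexShape.up ℕ)).obj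
        (deRhamComplexSheaf (Opens.grothendieckTopology X) φ) ≅
      deRhamComplexSheaf (Opens.grothendieckTopology Y)
        (Functor.whiskerLeft hf.isOpenMap.functor.op φ) :=
  haveI := additive_restrict hf
  haveI := isCocontinuous_functor hf
  haveI := hf.functor_isContinuous
  HomologicalComplex.Hom.isoOfComponents
    (fun n => ((hf.isOpenMap.functor.pushforwardContinuousSheafificationCompatibility
      AddCommGrpCat.{u} (Opens.grothendieckTopology Y) (Opens.grothendieckTopology X)).app
        (formsPresheaf φ n)).symm)
    (fun i j hij => by
      obtain rfl : i + 1 = j := hij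
      rw [Functor.mapHomologicalComplex_obj_d, deRhamComplexSheaf_d, deRhamComplexSheaf_d,
        Iso.symm_hom, Iso.symm_hom, Iso.app_inv, Iso.app_inv]
      exact ((hf.isOpenMap.functor.pushforwardContinuousSheafificationCompatibility
        AddCommGrpCat.{u} (Opens.grothendieckTopology Y)
          (Opens.grothendieckTopology X)).inv.naturality (deRhamDifferential φ i)).symm)

/-- The same for any `φ'` on `Y` known to be the restriction of `φ` (to absorb the definitional
unfolding of `f*S`, `f*R` in applications). [folklore] -/
def restrictDeRhamComplexSheafIso (φ' : hf.isOpenMap.functor.op ⋙ S ⟶ hf.isOpenMap.functor.op ⋙ R)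
    (hφ : φ' = Functor.whiskerLeft hf.isOpenMap.functor.op φ) :
    haveI := additive_restrict hf
    ((restrict hf AddCommGrpCat.{u}).mapHomologicalComplex (ComplexShape.up ℕ)).obj
        (deRhamComplexSheaf (Opens.grothendieckTopology X) φ) ≅
      deRhamComplexSheaf (Opens.grothendieckTopology Y) φ' :=
  restrictDeRhamComplexSheafWhiskerLeftIso hf φ ≪≫ eqToIso (by subst hφ; rfl)

end Sheaf

section SchemeSheaf

open Literature.Topology

variable {k : Type u} [CommRing k] (X : Over (Spec (CommRingCat.of k))) (U : X.left.Opens)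

/-- **`Ω•_{X/k}|_U ≅ Ω•_{U/k}`**: the algebraic de Rham complex of a `k`-scheme restricted to an
open subscheme `U` is the algebraic de Rham complex of `U/k`, as complexes of abelian sheaves on
`U` (the de Rham complex is local on `X`: Stacks 0FKL; EGA IV₄ 16.6).
[cite: StacksProject, Tag 0FKL] -/
def restrictAlgebraicDeRhamComplexIso :
    haveI := additive_restrict U.isOpenEmbedding
    ((restrict U.isOpenEmbedding AddCommGrpCat.{u}).mapHomologicalComplex (ComplexShape.up ℕ)).obj
        (algebraicDeRhamComplex X) ≅
      algebraicDeRhamComplex (openOver X U) :=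
  restrictDeRhamComplexSheafIso U.isOpenEmbedding (constToPresheaf X)
    (constToPresheaf (openOver X U))
    (constToPresheaf_openOver X U)

end SchemeSheaf

end Literature.AlgebraicGeometry.Crystalline
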